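import Summits.AtomisticToContinuum.FouriersLaw.Theorems.HonestZwanzigPositiveMemoryFeshbachDuality
import Summits.AtomisticToContinuum.FouriersLaw.Theorems.HonestZwanzigPositiveMemoryProfileForm
import Summits.AtomisticToContinuum.FouriersLaw.Theorems.HonestZwanzigPositiveMemoryProfileVariance

/-!
# HonestZwanzig / PositiveMemory — the Robin reduction (line `Sketch`)

Support file for item `stmt-AtomisticToContinuum-12694` (`PositiveMemory` of route `HonestZwanzig`, sub-problem
`FouriersLaw`): the composition of line `Sketch` that leans on the route's crux #4 `RobinCoercivity`. Robin coercivity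
tested on the tent profile `ξ_x = min(x, N−1−x)` gives `ξᵀ𝔽(s)ξ ≥ c(N−2)/2` (`tent_robin_ge`); the landed profile form
(`stub_profileForm`) turns it into `schur_s(J_ξ,J_ξ) ≥ c(N−2)/2 − s·cov(E_ξ,E_ξ)`; the one-sided `o(N)` cross-apex
memory bound (stub `stub_apexLocalityEps`) into the floor `Σ_b ρ_b ≥ (c/2 − ε)N − C` on the orthogonal-dynamics DC
responses of `OrthogonalOhm` (`fixedN_floor_robin`, limit `s ↓ 0` at fixed `N`); the bulk homogeneity and boundedness of
`OrthogonalOhm` then force `k ≥ c/2` (`ohm_floor`), and every bulk limit is the Ohm response (uniqueness of limits in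
`𝓝[>] 0`), hence `≥ c/4` (`stub_robinReduction`). For the route, which stakes `RobinCoercivity` anyway, crux #3 thus
carries no risk beyond cruxes #2, #4 and `stub_apexLocalityEps`. The companion `…PositiveMemoryTentReduction` replaces
`RobinCoercivity` by the tent-escape bound via the Feshbach duality.
-/

noncomputable section

open MeasureTheory Finset Real Set Filter Topology
open Literature.MathematicalPhysics.KineticTheory.HeatConduction
open Summit.AtomisticToContinuum.FouriersLaw.Theorems.HonestZwanzig.NetworkReduction

namespace Summit.AtomisticToContinuum.FouriersLaw.Theorems.HonestZwanzig.PositiveMemory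


/-! ### Elementary lemmas -/

/-- **Ohm bookkeeping, `N → ∞`.** If the responses `ρ_N` satisfy `|ρ_N(b) − k| ≤ C + |k|` on every
bond and, for every `ε > 0`, `|ρ_N(b) − k| ≤ ε` on the bonds at distance `≥ R(ε)` from both ends, while
`Σ_b ρ_N(b) ≥ κN − C_A` for all large `N`, then `κ ≤ k`. -/
theorem ohm_floor {k C κ CA : ℝ} {N₁ : ℕ} (ρ : (N : ℕ) → Fin N → ℝ) (hC : 0 ≤ C)
    (hall : ∀ N : ℕ, N₁ ≤ N → ∀ b : Fin N, |ρ N b - k| ≤ C + |k|)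
    (hbulk : ∀ ε : ℝ, 0 < ε → ∃ R : ℕ, ∀ N : ℕ, N₁ ≤ N → ∀ b : Fin N,
      R ≤ b.val → b.val + 2 + R ≤ N → |ρ N b - k| ≤ ε)
    (hfloor : ∀ N : ℕ, N₁ ≤ N → κ * N - CA ≤ ∑ b, ρ N b) : κ ≤ k := by
  by_contra hlt
  push Not at hlt
  set ε : ℝ := (κ - k) / 2 with hε
  have hεpos : 0 < ε := by rw [hε]; linarith
  obtain ⟨R, hR⟩ := hbulk ε hεpos
  set K : ℝ := (2 * R + 1) * (C + |k|) with hK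
  obtain ⟨N, hN⟩ := exists_nat_gt (max (N₁ : ℝ) ((CA + K) / ε))
  have hN₁ : N₁ ≤ N := by
    have : (N₁ : ℝ) < N := (le_max_left _ _).trans_lt hN
    exact_mod_cast this.le
  have hNε : (CA + K) / ε < N := (le_max_right _ _).trans_lt hN
  -- upper bound on the sum of responses
  have hsum : ∑ b, ρ N b ≤ N * k + (N * ε + (2 * R + 1) * (C + |k|)) := by
    have h1 : ∑ b, ρ N b ≤ ∑ b : Fin N, (k + |ρ N b - k|) :=
      Finset.sum_le_sum fun b _ => by linarith [le_abs_self (ρ N b - k)]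
    have h2 : ∑ b : Fin N, (k + |ρ N b - k|) = N * k + ∑ b : Fin N, |ρ N b - k| := by
      rw [Finset.sum_add_distrib, Finset.sum_const, Finset.card_univ, Fintype.card_fin, nsmul_eq_mul]
    have h3 := sum_abs_le_of_bulk R (fun b : Fin N => ρ N b - k) hεpos.le (by positivity)
      (fun b h1 h2 => hR N hN₁ b h1 h2) (fun b => hall N hN₁ b)
    linarith
  have hfl := hfloor N hN₁
  -- `N ε ≤ C_A + K`, contradiction
  have h4 : (N : ℝ) * ε ≤ CA + K := by
    have : κ - k - ε = ε := by rw [hε]; ring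
    nlinarith
  rw [div_lt_iff₀ hεpos] at hNε
  linarith


/-- **The tent profile has extensive Robin energy**: for `ξ_x = min(x, N−1−x)`,
`Σ_b (ξ_{b+1} − ξ_b)² + ξ_0² + ξ_{N−1}² ≥ (N − 2)/2` (the left half of the bonds have slope `1`). -/
theorem tent_robin_ge {N : ℕ} (hN : 2 ≤ N) (ξ : Fin N → ℝ)
    (hξ : ∀ x : Fin N, ξ x = ((min x.val (N - 1 - x.val) : ℕ) : ℝ)) :
    ((N : ℝ) - 2) / 2 ≤ ∑ i : Fin N, ((∑ j : Fin N, if j.val = i.val + 1 then (ξ j - ξ i) ^ 2 else 0) +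
      (if i.val = 0 then ξ i ^ 2 else 0) + (if i.val = N - 1 then ξ i ^ 2 else 0)) := by
  set m : ℕ := (N - 1) / 2 with hm
  have hm2 : N ≤ 2 * m + 2 := by omega
  -- the bond part as a function of the site index
  set ξ' : ℕ → ℝ := fun n => ((min n (N - 1 - n) : ℕ) : ℝ) with hξ'
  set g : ℕ → ℝ := fun n => if n + 1 < N then (ξ' (n + 1) - ξ' n) ^ 2 else 0 with hg
  have hinner : ∀ i : Fin N, (∑ j : Fin N, if j.val = i.val + 1 then (ξ j - ξ i) ^ 2 else 0) = g i.val := by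
    intro i
    by_cases hi : i.val + 1 < N
    · rw [sum_ite_val_eq (i.val + 1) hi (fun j => (ξ j - ξ i) ^ 2)]
      simp only [hg, if_pos hi, hξ, hξ']
    · rw [Finset.sum_eq_zero]
      · simp only [hg, if_neg hi]
      · intro j _
        have hj := j.isLt
        rw [if_neg (by omega)]
  -- drop the (nonnegative) contact terms and pass to a range sum
  have h1 : ∑ i : Fin N, g i.val ≤ ∑ i : Fin N, ((∑ j : Fin N, if j.val = i.val + 1 then (ξ j - ξ i) ^ 2 else 0) +
      (if i.val = 0 then ξ i ^ 2 else 0) + (if i.val = N - 1 then ξ i ^ 2 else 0)) := by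
    refine Finset.sum_le_sum fun i _ => ?_
    rw [hinner i]
    have h0 : 0 ≤ (if i.val = 0 then ξ i ^ 2 else 0) := by split_ifs <;> positivity
    have h0' : 0 ≤ (if i.val = N - 1 then ξ i ^ 2 else 0) := by split_ifs <;> positivity
    linarith
  have h2 : ∑ i : Fin N, g i.val = ∑ n ∈ Finset.range N, g n := Fin.sum_univ_eq_sum_range g N
  have hsub : Finset.range m ⊆ Finset.range N := by
    intro x hx
    simp only [Finset.mem_range] at hx ⊢
    omega
  have h3 : ∑ n ∈ Finset.range m, g n ≤ ∑ n ∈ Finset.range N, g n :=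
    Finset.sum_le_sum_of_subset_of_nonneg hsub fun n _ _ => by
      simp only [hg]
      split_ifs <;> positivity
  have h4 : ∀ n ∈ Finset.range m, g n = 1 := by
    intro n hn
    rw [Finset.mem_range] at hn
    have hn1 : n + 1 < N := by omega
    have ha : min (n + 1) (N - 1 - (n + 1)) = n + 1 := min_eq_left (by omega)
    have hb : min n (N - 1 - n) = n := min_eq_left (by omega)
    simp only [hg, if_pos hn1, hξ', ha, hb]
    push_cast
    ring
  rw [Finset.sum_congr rfl h4, Finset.sum_const, Finset.card_range, nsmul_eq_mul, mul_one] at h3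
  have hmR : (N : ℝ) ≤ 2 * m + 2 := by exact_mod_cast hm2
  linarith

/-- **The fixed-`s` bound, Robin form.** If `total = Σ_b σ_b`, `tent ≤ total + Λ`, `form = s·V + tent` and
`r ≤ form`, then `r − s·V − Λ ≤ Σ_b σ_b`. -/
theorem fixed_s_bound_robin {ι : Type*} [Fintype ι] {σ : ι → ℝ} {total tent form r V Λ s : ℝ}
    (hadd : total = ∑ b, σ b) (hloc : tent ≤ total + Λ) (hform : form = s * V + tent) (hr : r ≤ form) :
    r - s * V - Λ ≤ ∑ b, σ b := by
  rw [← hadd]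
  linarith

/-! ### The fixed-`N` floor, Robin form -/

section Package

variable {ω₂ lam β γ : ℝ} {N : ℕ} {T : ℝ}
  {Adm : (PhaseSpace N → ℝ) → Prop}
  {corr : (PhaseSpace N → ℝ) → (PhaseSpace N → ℝ) → ℝ → ℝ}
  {lap : ℝ → (PhaseSpace N → ℝ) → (PhaseSpace N → ℝ) → ℝ}
  {cov : (PhaseSpace N → ℝ) → (PhaseSpace N → ℝ) → ℝ}
  {e : Fin N → PhaseSpace N → ℝ}
  {G : ℝ → Matrix (Fin N) (Fin N) ℝ}
  {schur : ℝ → (PhaseSpace N → ℝ) → (PhaseSpace N → ℝ) → ℝ}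
  {F : ℝ → Fin N → Fin N → ℝ}
  (hAdm : ∀ f, Adm f ↔ (Continuous f ∧ ∃ A : ℝ, ∀ z,
    |f z| ≤ A * Real.exp ((pinnedChain ω₂ lam β γ).hamiltonian N z / (8 * T))))
  (hcorr : ∀ f g t, corr f g t =
    (∫ z, f z * (∫ y, g y ∂((pinnedChain ω₂ lam β γ).transitionKernel N T T t.toNNReal z))
      ∂(pinnedChain ω₂ lam β γ).gibbsMeasure N T) -
    (∫ z, f z ∂(pinnedChain ω₂ lam β γ).gibbsMeasure N T) *
      (∫ z, g z ∂(pinnedChain ω₂ lam β γ).gibbsMeasure N T))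
  (hlap : ∀ s f g, lap s f g = ∫ t in Set.Ioi (0 : ℝ), Real.exp (-(s * t)) * corr f g t)
  (hcov : ∀ f g, cov f g = (∫ z, f z * g z ∂(pinnedChain ω₂ lam β γ).gibbsMeasure N T) -
    (∫ z, f z ∂(pinnedChain ω₂ lam β γ).gibbsMeasure N T) *
      (∫ z, g z ∂(pinnedChain ω₂ lam β γ).gibbsMeasure N T))
  (he : ∀ x z, e x z = z.2 x ^ 2 / 2 + (pinnedChain ω₂ lam β γ).U (z.1 x) +
    ∑ j : Fin N, ((if j.val = x.val + 1 then (pinnedChain ω₂ lam β γ).V (z.1 j - z.1 x) / 2 else 0) +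
      (if x.val = j.val + 1 then (pinnedChain ω₂ lam β γ).V (z.1 x - z.1 j) / 2 else 0)))
  (hG : ∀ s x y, G s x y = lap s (e x) (e y))
  (hschur : ∀ s f g, schur s f g = lap s f g - ∑ x, ∑ y, lap s f (e x) * (G s)⁻¹ x y * lap s (e y) g)
  (hF : ∀ s x y, F s x y = s * cov (e x) (e y) - cov (e x) ((pinnedChain ω₂ lam β γ).generator N T T (e y)) -
      schur s (fun z => (pinnedChain ω₂ lam β γ).generator N T T (e x) (z.1, -z.2))
        ((pinnedChain ω₂ lam β γ).generator N T T (e y)))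
  (hFI : ∀ f g : PhaseSpace N → ℝ, Adm f → Adm g →
    Integrable f ((pinnedChain ω₂ lam β γ).gibbsMeasure N T) ∧
    (∀ t : ℝ, 0 ≤ t → Integrable (fun z => f z *
      (∫ y, g y ∂((pinnedChain ω₂ lam β γ).transitionKernel N T T t.toNNReal z)))
      ((pinnedChain ω₂ lam β γ).gibbsMeasure N T)) ∧
    IntegrableOn (corr f g) (Set.Ioi 0) ∧
    (∀ t : ℝ, 0 ≤ t → corr f g t = corr (fun z => g (z.1, -z.2)) (fun z => f (z.1, -z.2)) t) ∧
    (∀ s : ℝ, 0 < s → ∀ x : Fin N,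
      s * lap s (e x) g - cov (e x) g =
        lap s (fun z => (pinnedChain ω₂ lam β γ).generator N T T (e x) (z.1, -z.2)) g ∧
      s * lap s f (e x) - cov f (e x) = lap s f ((pinnedChain ω₂ lam β γ).generator N T T (e x))))
  (hGSE : ∀ (x : Fin N) (z : PhaseSpace N), (pinnedChain ω₂ lam β γ).generator N T T (e x) z =
    (∑ b : Fin N, ((if x.val = b.val + 1 then (pinnedChain ω₂ lam β γ).bondCurrent N b z else 0) -
      (if b = x then (pinnedChain ω₂ lam β γ).bondCurrent N b z else 0))) +
    (if x.val = 0 then (pinnedChain ω₂ lam β γ).γ * (T - z.2 x ^ 2) else 0) +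
    (if x.val = N - 1 then (pinnedChain ω₂ lam β γ).γ * (T - z.2 x ^ 2) else 0))
  (hPS : ∀ x y : Fin N, cov (e x) ((pinnedChain ω₂ lam β γ).generator N T T (e y)) =
    -(if x = y ∧ (x.val = 0 ∨ x.val = N - 1) then (pinnedChain ω₂ lam β γ).γ * T ^ 2 else 0))
  (hω : 0 < ω₂) (hl : 0 ≤ lam) (hβ : 0 ≤ β) (hT : 0 < T)

include hAdm hcorr hlap hcov he hschur hF hFI hGSE hPS hω hl hβ hT in
/-- **The fixed-`N` floor, Robin form.** At `N ≥ 2`, with the tent profile `ξ` and its current `J_ξ`: if the Feshbach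
matrix dominates `c`·(path Laplacian + Robin ends) and `schur_s(J_ξ,J_ξ) ≤ schur_s(J,J) + Λ` for `0 < s < s₀`, then the
orthogonal-dynamics DC responses satisfy `c(N − 2)/2 − Λ ≤ Σ_b ρ_b`. -/
theorem fixedN_floor_robin (hN : 2 ≤ N)
    (ξ : Fin N → ℝ) (hξ : ∀ x : Fin N, ξ x = ((min x.val (N - 1 - x.val) : ℕ) : ℝ))
    {Jξ : PhaseSpace N → ℝ}
    (hJξ : Jξ = fun z => ∑ b : Fin N, (∑ j : Fin N, if j.val = b.val + 1 then ξ j - ξ b else 0) *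
      (pinnedChain ω₂ lam β γ).bondCurrent N b z)
    {c Λ s₀ : ℝ} (hc : 0 < c) (hs₀ : 0 < s₀)
    (hRobin : ∀ s : ℝ, 0 < s → s < s₀ → ∀ ζ : Fin N → ℝ, c * (∑ i : Fin N, ((∑ j : Fin N,
        if j.val = i.val + 1 then (ζ j - ζ i) ^ 2 else 0) + (if i.val = 0 then ζ i ^ 2 else 0) +
        (if i.val = N - 1 then ζ i ^ 2 else 0))) ≤ ∑ x, ∑ y, ζ x * F s x y * ζ y)
    (hloc : ∀ s : ℝ, 0 < s → s < s₀ → schur s Jξ Jξ ≤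
      schur s (fun z => ∑ i : Fin N, (pinnedChain ω₂ lam β γ).bondCurrent N i z)
        (fun z => ∑ i : Fin N, (pinnedChain ω₂ lam β γ).bondCurrent N i z) + Λ)
    (ρ : Fin N → ℝ)
    (hρ : ∀ b : Fin N, b.val + 1 < N → Tendsto (fun s => schur s ((pinnedChain ω₂ lam β γ).bondCurrent N b)
      (fun z => ∑ i : Fin N, (pinnedChain ω₂ lam β γ).bondCurrent N i z)) (nhdsWithin (0 : ℝ) (Set.Ioi 0))
      (nhds (ρ b)))
    (hρ0 : ∀ b : Fin N, ¬ b.val + 1 < N → ρ b = 0) :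
    c * (((N : ℝ) - 2) / 2) - Λ ≤ ∑ b, ρ b := by
  set J : PhaseSpace N → ℝ := fun z => ∑ i : Fin N, (pinnedChain ω₂ lam β γ).bondCurrent N i z with hJ
  set j : Fin N → PhaseSpace N → ℝ := (pinnedChain ω₂ lam β γ).bondCurrent N with hj
  have hJa : Adm J := adm_totalCurrent Adm hAdm hω hl hβ hT
  have hex : ∀ x, Adm (e x) := fun x => adm_e Adm hAdm e he hω hl hβ hT x
  have hρ' : ∀ b : Fin N, Tendsto (fun s => schur s (j b) J) (nhdsWithin (0 : ℝ) (Set.Ioi 0))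
      (nhds (ρ b)) := by
    intro b
    by_cases hb : b.val + 1 < N
    · exact hρ b hb
    · have h0 : ∀ s, schur s (j b) J = 0 := by
        intro s
        rw [hschur, pkg_j_last hcorr hlap s b hb, zero_sub, neg_eq_zero]
        refine Finset.sum_eq_zero fun x _ => Finset.sum_eq_zero fun y _ => ?_
        rw [pkg_j_last hcorr hlap s b hb, zero_mul, zero_mul]
      rw [show (fun s => schur s (j b) J) = fun _ => 0 from funext h0, hρ0 b hb]
      exact tendsto_const_nhds
  have hUB : Tendsto (fun s => ∑ b, schur s (j b) J) (nhdsWithin (0 : ℝ) (Set.Ioi 0))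
      (nhds (∑ b, ρ b)) := tendsto_finsetSum _ fun b _ => hρ' b
  set V : ℝ := cov (fun z => ∑ x, ξ x * e x z) (fun z => ∑ x, ξ x * e x z) with hV
  set r : ℝ := c * (((N : ℝ) - 2) / 2) with hr
  have hLB : Tendsto (fun s : ℝ => r - s * V - Λ) (nhdsWithin (0 : ℝ) (Set.Ioi 0)) (nhds (r - Λ)) := by
    have hcont : Continuous fun s : ℝ => r - s * V - Λ := by fun_prop
    have h := hcont.tendsto 0
    simp only [zero_mul, sub_zero] at h
    exact h.mono_left nhdsWithin_le_nhds
  have hξb : ∀ x : Fin N, (x.val = 0 ∨ x.val = N - 1) → ξ x = 0 := by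
    intro x hx
    rw [hξ]
    rcases hx with h | h <;> simp [h]
  have hsand : ∀ᶠ s in nhdsWithin (0 : ℝ) (Set.Ioi 0), r - s * V - Λ ≤ ∑ b, schur s (j b) J := by
    filter_upwards [Ioo_mem_nhdsGT hs₀] with s hs
    have hs1 : 0 < s := hs.1
    have hadd : schur s J J = ∑ b, schur s (j b) J := by
      have h := schur_lincomb (lap s) (schur s) e J (G s) (hschur s) (fun _ => 1) 0 J J j
        (by rw [pkg_J_lap hAdm hcorr hlap hFI hω hl hβ hT hs1.le hJa]; simp [hj])
        (fun u => by rw [pkg_J_lap hAdm hcorr hlap hFI hω hl hβ hT hs1.le (hex u)]; simp [hj])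
      rw [h]
      simp
    have hform := fixedN_profileForm hAdm hcorr hlap hcov he hFI hGSE hPS hω hl hβ hT ξ hξb hJξ hs1.le
      (G s) (schur s) (hschur s) (F s) (hF s)
    have hrob := hRobin s hs1 hs.2 ξ
    have htent := tent_robin_ge hN ξ hξ
    have hr' : r ≤ ∑ x, ∑ y, ξ x * F s x y * ξ y := (mul_le_mul_of_nonneg_left htent hc.le).trans hrob
    exact fixed_s_bound_robin hadd (hloc s hs1 hs.2) hform hr'
  exact le_of_tendsto_of_tendsto hLB hUB hsand

end Package

/-! ### The registered stub: the Robin reduction -/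

/-- **Stub — the Robin reduction** (second composition of line `Sketch`, leaning on crux #4 instead of tent escape):
`FeshbachIdentities`, `OrthogonalOhm`, `RobinCoercivity` and apex sub-extensivity imply `PositiveMemory`. Robin
coercivity tested on the tent gives `ξᵀ𝔽(s)ξ ≥ c(N−2)/2` at once, the profile form turns it into
`schur_s(J_ξ,J_ξ) ≥ c(N−2)/2 − s·cov(E_ξ,E_ξ)`, apex sub-extensivity into `Σ_b ρ_b ≥ (c/2 − ε)N − C`, so `k ≥ c/2`
(`ohm_floor`) and every bulk limit is `≥ c/4`. For the route (which stakes `RobinCoercivity` anyway) crux #3 thus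
carries no risk beyond #2, #4 and the one-sided `o(N)` cross-apex memory bound. -/
theorem stub_robinReduction :
    Summit.AtomisticToContinuum.FouriersLaw.Theses.HonestZwanzig.FeshbachIdentities →
    Summit.AtomisticToContinuum.FouriersLaw.Theses.HonestZwanzig.OrthogonalOhm →
    Summit.AtomisticToContinuum.FouriersLaw.Theses.HonestZwanzig.RobinCoercivity →
    (
      ∀ ω₂ lam β γ : ℝ, 0 < ω₂ → 0 < lam → 0 < β → 0 < γ → ∀ T : ℝ, 0 < T → ∀ ε : ℝ, 0 < ε → ∃ C_A : ℝ, ∀ N : ℕ, 2 ≤ N →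
      let P := Literature.MathematicalPhysics.KineticTheory.HeatConduction.pinnedChain ω₂ lam β γ;
      let X := Literature.MathematicalPhysics.KineticTheory.HeatConduction.PhaseSpace N;
      let μ : MeasureTheory.Measure X := P.gibbsMeasure N T;
      let corr : (X → ℝ) → (X → ℝ) → ℝ → ℝ := fun f g t =>
        (∫ z, f z * (∫ y, g y ∂(P.transitionKernel N T T t.toNNReal z)) ∂μ) - (∫ z, f z ∂μ) * (∫ z, g z ∂μ);
      let lap : ℝ → (X → ℝ) → (X → ℝ) → ℝ := fun s f g =>
        ∫ t in Set.Ioi (0 : ℝ), Real.exp (-(s * t)) * corr f g t;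
      let e : Fin N → X → ℝ := fun x z => z.2 x ^ 2 / 2 + P.U (z.1 x) +
        ∑ j : Fin N, ((if j.val = x.val + 1 then P.V (z.1 j - z.1 x) / 2 else 0) +
          (if x.val = j.val + 1 then P.V (z.1 x - z.1 j) / 2 else 0));
      let G : ℝ → Matrix (Fin N) (Fin N) ℝ := fun s => Matrix.of fun x y => lap s (e x) (e y);
      let schur : ℝ → (X → ℝ) → (X → ℝ) → ℝ := fun s f g =>
        lap s f g - ∑ x : Fin N, ∑ y : Fin N, lap s f (e x) * (G s)⁻¹ x y * lap s (e y) g;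
      let J : X → ℝ := fun z => ∑ i : Fin N, P.bondCurrent N i z;
      let ξ : Fin N → ℝ := fun x => ((min x.val (N - 1 - x.val) : ℕ) : ℝ);
      let Jξ : X → ℝ := fun z =>
        ∑ b : Fin N, (∑ j : Fin N, if j.val = b.val + 1 then ξ j - ξ b else 0) * P.bondCurrent N b z;
      ∃ s₀ : ℝ, 0 < s₀ ∧ ∀ s : ℝ, 0 < s → s < s₀ → schur s Jξ Jξ ≤ schur s J J + (ε * (N : ℝ) + C_A)) →
    Summit.AtomisticToContinuum.FouriersLaw.Theses.HonestZwanzig.PositiveMemory := by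
  intro hFI hOO hRC hA ω₂ lam β γ hω hl hβ hγ T hT
  obtain ⟨k, C, hkC⟩ := hOO ω₂ lam β γ hω hl hβ hγ T hT
  obtain ⟨c, hc, hRCN⟩ := hRC ω₂ lam β γ hω hl hβ hγ T hT
  -- the orthogonal-dynamics DC responses, chosen once (`ε = 1`)
  obtain ⟨R₁, hR₁⟩ := hkC 1 one_pos
  have hb1 := fun (N : ℕ) (hN : 2 ≤ N) => (hR₁ N hN).1
  choose ρf hρf using hb1
  have hC0 : 0 ≤ C := (abs_nonneg _).trans (hρf 2 le_rfl ⟨0, by norm_num⟩ (by norm_num)).2.1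
  set ρ : (N : ℕ) → Fin N → ℝ := fun N b => if h : 2 ≤ N ∧ b.val + 1 < N then ρf N h.1 b h.2 else 0 with hρ
  have hρt : ∀ (N : ℕ) (hN : 2 ≤ N) (b : Fin N) (hb : b.val + 1 < N), ρ N b = ρf N hN b hb := by
    intro N hN b hb
    simp only [hρ, dif_pos (And.intro hN hb)]
  have hρ0 : ∀ (N : ℕ) (b : Fin N), ¬ b.val + 1 < N → ρ N b = 0 := by
    intro N b hb
    simp only [hρ]
    rw [dif_neg]
    exact fun h => hb h.2
  set κ : ℝ := c / 2 with hκ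
  have hκ0 : 0 < κ := by positivity
  -- Step A: for every `ε > 0`, `Σ_b ρ_b ≥ (κ − ε) N − (c + C_A(ε))` for every `N ≥ 6`
  have hfloor : ∀ ε : ℝ, 0 < ε → ∃ CA : ℝ, ∀ N : ℕ, 6 ≤ N → (κ - ε) * N - CA ≤ ∑ b, ρ N b := by
    intro ε hε
    obtain ⟨CA, hCA⟩ := hA ω₂ lam β γ hω hl hβ hγ T hT ε hε
    refine ⟨c + CA, fun N hN6 => ?_⟩
    have hN : 2 ≤ N := by omega
    obtain ⟨-, hFI2, -, -⟩ := hFI ω₂ lam β γ hω hl hβ hγ T hT N hN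
    obtain ⟨s₁, hs₁, hRob⟩ := hRCN N hN
    obtain ⟨s₂, hs₂, hloc⟩ := hCA N hN
    have key := fixedN_floor_robin (ω₂ := ω₂) (lam := lam) (β := β) (γ := γ) (N := N) (T := T)
      (fun f => Iff.rfl) (fun f g t => rfl) (fun s f g => rfl) (fun f g => rfl) (fun x z => rfl)
      (fun s f g => rfl) (fun s x y => rfl) hFI2
      (fun x z => generatorSiteEnergy_proof ω₂ lam β γ N hN T T x z)
      (fun x y => ((parityStatics_proof ω₂ lam β γ hω hl hβ hγ T hT N hN) x).2 y)
      hω hl.le hβ.le hT hN (fun x => ((min x.val (N - 1 - x.val) : ℕ) : ℝ)) (fun x => rfl) rfl hc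
      (lt_min hs₁ hs₂) (fun s hs hs' => hRob s hs (hs'.trans_le (min_le_left _ _)))
      (fun s hs hs' => hloc s hs (hs'.trans_le (min_le_right _ _))) (ρ N)
      (fun b hb => by rw [hρt N hN b hb]; exact (hρf N hN b hb).1) (fun b hb => hρ0 N b hb)
    have hκN : (κ - ε) * N - (c + CA) = c * (((N : ℝ) - 2) / 2) - (ε * N + CA) := by rw [hκ]; ring
    rw [hκN]
    exact key
  -- Step B: the Ohm constant is at least `κ`
  have hall : ∀ N : ℕ, 6 ≤ N → ∀ b : Fin N, |ρ N b - k| ≤ C + |k| := by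
    intro N hN b
    by_cases hb : b.val + 1 < N
    · have hN2 : 2 ≤ N := by omega
      rw [hρt N hN2 b hb]
      have h := (hρf N hN2 b hb).2.1
      calc |ρf N hN2 b hb - k| ≤ |ρf N hN2 b hb| + |k| := abs_sub _ _
        _ ≤ C + |k| := by linarith
    · rw [hρ0 N b hb, zero_sub, abs_neg]
      linarith [abs_nonneg k]
  have hbulk : ∀ ε : ℝ, 0 < ε → ∃ R : ℕ, ∀ N : ℕ, 6 ≤ N → ∀ b : Fin N,
      R ≤ b.val → b.val + 2 + R ≤ N → |ρ N b - k| ≤ ε := by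
    intro ε hε
    obtain ⟨R, hR⟩ := hkC ε hε
    refine ⟨R, fun N hN b h1 h2 => ?_⟩
    have hN2 : 2 ≤ N := by omega
    have hb : b.val + 1 < N := by omega
    obtain ⟨hbonds, -⟩ := hR N hN2
    obtain ⟨ρ', hρ', -, hρ'k⟩ := hbonds b hb
    have heq : ρf N hN2 b hb = ρ' := tendsto_nhds_unique (hρf N hN2 b hb).1 hρ'
    rw [hρt N hN2 b hb, heq]
    exact hρ'k h1 h2
  have hk : κ ≤ k := by
    refine le_of_forall_pos_le_add fun ε hε => ?_
    obtain ⟨CA, hCA⟩ := hfloor ε hε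
    have h := ohm_floor (N₁ := 6) ρ hC0 hall hbulk hCA
    linarith
  -- Step C: every bulk limit is the Ohm response, hence `≥ k − κ/2 ≥ κ/2`
  refine ⟨κ / 2, by positivity, ?_⟩
  obtain ⟨R, hR⟩ := hkC (κ / 2) (by positivity)
  refine ⟨R, fun N hN => ?_⟩
  intro P X μ corr lap e G schur J b hRb hbN ρ₀ hρ₀
  have hb : b.val + 1 < N := by omega
  obtain ⟨hbonds, -⟩ := hR N hN
  obtain ⟨ρ', hρ', -, hρ'k⟩ := hbonds b hb
  have heq : ρ₀ = ρ' := tendsto_nhds_unique hρ₀ hρ'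
  have h1 := hρ'k hRb hbN
  rw [abs_le] at h1
  rw [heq]
  linarith

end Summit.AtomisticToContinuum.FouriersLaw.Theorems.HonestZwanzig.PositiveMemory

end
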